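import Literature.NumberTheory.Sieve.Maynard2016Lemma4Proof
import HarnessLib

/-!
# Maynard 2016: the kernel-checked chain `Lemma 2 ∧ Lemma 3 ∧ Proposition 5 ⊢ Theorem 1`

Topic `Literature/NumberTheory/Sieve`. Everything in this file is PROVED (pure composition of the
tree's proved reductions). After `Maynard2016.reduction_holds` (Lemma 2 → Lemma 4 → Proposition 5 →
covering theorem, the Erdős–Rankin argument of §2) and `Maynard2016.lemma4_of_lemma3` (Lemma 4 from
Lemma 3), the only inputs of J. Maynard, *Large gaps between primes*, Ann. of Math. 183 (2016),
Theorem 1, that remain NAMED FACTS are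

* `Maynard2016.Lemma2` — the Maier–Pomerance bound for shifted smooth numbers [MaierPomerance1990];
* `Maynard2016.Lemma3` — the fundamental lemma + Bombieri–Vinogradov count (first display);
* `Maynard2016.Proposition5` — the dense-cluster proposition (the GPY–Maynard sieve, §§4–8).

This file records the composed implications as citable theorems (routes may take the three facts as
hypotheses `(h₂ : Lemma2) (h₃ : Lemma3) (h₅ : Proposition5)`).

## References

* J. Maynard, *Large gaps between primes*, Ann. of Math. (2) 183 (2016), 915–933; arXiv:1408.5110,
  §2 and Theorem 1. [Maynard2016LargeGaps]
-/

namespace Literature.NumberTheory.Sieve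

namespace Maynard2016

/-- **Covering theorem from the three analytic inputs.** [cite: Maynard2016LargeGaps, §2
(«We now prove Theorem 1 assuming Proposition 5»)] -/
theorem coveringTheorem_of_lemmas (h₂ : Literature.NumberTheory.Sieve.Maynard2016.Lemma2)
    (h₃ : Literature.NumberTheory.Sieve.Maynard2016.Lemma3)
    (h₅ : Literature.NumberTheory.Sieve.Maynard2016.Proposition5) :
    Literature.NumberTheory.Sieve.Maynard2016.CoveringTheorem :=
  reduction_holds h₂ (lemma4_of_lemma3 h₃) h₅

/-- **Maynard 2016, Theorem 1 from Lemma 2, Lemma 3 and Proposition 5** (kernel-checked chain).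
[cite: Maynard2016LargeGaps, Thm 1] -/
theorem theorem1_of_lemmas (h₂ : Literature.NumberTheory.Sieve.Maynard2016.Lemma2)
    (h₃ : Literature.NumberTheory.Sieve.Maynard2016.Lemma3)
    (h₅ : Literature.NumberTheory.Sieve.Maynard2016.Proposition5) :
    Literature.NumberTheory.Sieve.Maynard2016_theorem1 :=
  theorem1_of_coveringTheorem (coveringTheorem_of_lemmas h₂ h₃ h₅)

/-- **Every Rankin constant** from Lemma 2, Lemma 3 and Proposition 5: for every `c`, gaps
`≥ c log X log₂ X log₄ X/(log₃ X)²` below `X` infinitely often. [cite: Maynard2016LargeGaps, Thm 1] -/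
theorem forall_rankinConstant_of_lemmas (h₂ : Literature.NumberTheory.Sieve.Maynard2016.Lemma2)
    (h₃ : Literature.NumberTheory.Sieve.Maynard2016.Lemma3)
    (h₅ : Literature.NumberTheory.Sieve.Maynard2016.Proposition5) (c : ℝ) :
    Literature.NumberTheory.Sieve.RankinConstant c :=
  forall_rankinConstant_of_coveringTheorem (coveringTheorem_of_lemmas h₂ h₃ h₅) c

end Maynard2016

end Literature.NumberTheory.Sieve
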